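import Summits.ValiantsHypothesis.ValiantsHypothesis.Theorems.NewtonUnitEquationsTwoProductsMomentRecordLiftTransfer

/-!
# R12 lift toolkit — Euler derivation and the Wronskian transport

(2/5) Degree congruences between tame polynomials are top congruences; inverse modulo degree; the EULER DERIVATION `θ_κ` (`coeff e (θ_κ P) = lw κ e · coeff e P`); truncated logarithms `logT`, their exact derivative, the upstairs WRONSKIAN congruence `P·Q·θΛ ≡ θF·Q − F·θQ` in bounded degree, and the TOP TRANSPORT `topEq_logT_of_topEq_prod`: if `Π(1+ℓ) − Π(1+ℓ')` is top-congruent to one monomial `G·Y^{e₀}` of weight `w₀`, so is `Σ log_{R+1}(1+ℓ) − Σ log_{R+1}(1+ℓ')` (the tree's `stub_logLinearisation` mechanism, run upstairs with total degree as truncation order).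
Helper on crux `stmt-ValiantsHypothesis-5906` (line `relation_ladder`, R12 «moment record law», crit-8 g2's texts ✓ `…MomentRecordDefs` / `…MomentRecordRungDefs`); `--supports`, closes nothing by itself: (A∘) `MomentRecordLawUsed`, the rung (B), `PlanarCellBound` and the crux stay OPEN; VP ≠ VNP is NOT proved.  No instances, no notation, no named facts. [folklore]
-/

set_option linter.dupNamespace false

noncomputable section

open Classical

namespace Summit.ValiantsHypothesis.ValiantsHypothesis.Theorems.NewtonUnitEquations.TwoProducts.MomentRecord.Lift
open scoped BigOperators
open MvPolynomial

section Wronskian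

variable {σ : Type*} [Fintype σ]

section TameDeg

/-- A DEGREE congruence between TAME polynomials (`c > 0`) is a TOP congruence at every level `w₀` with `−w₀ ≤ c·R`:
monomials at or above `w₀` have degree `≤ R`. [folklore] -/
theorem topEq_of_degEq {κ : σ → ℝ} {c w₀ : ℝ} {R : ℕ} (hc : 0 < c) (hR : -w₀ ≤ c * R) {P Q : MvPolynomial σ ℂ}
    (hP : Tame κ c P) (hQ : Tame κ c Q) (h : DegEq R P Q) : TopEq κ w₀ P Q := by
  intro e he
  by_cases hmem : e ∈ P.support ∪ Q.support
  · rcases Finset.mem_union.1 hmem with hm | hm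
    · exact h e (hP.degree_le hc hR hm he)
    · exact h e (hQ.degree_le hc hR hm he)
  · rw [Finset.mem_union, not_or, notMem_support_iff, notMem_support_iff] at hmem
    rw [hmem.1, hmem.2]

/-- INVERSE MODULO DEGREE: a polynomial with constant term `1` has, for every `R`, a right inverse up to degree `R`,
namely `Σ_{t ≤ R} (1 − P)^t`; it is tame when `P` is. [folklore] -/
theorem exists_degEq_mul_one {κ : σ → ℝ} {c : ℝ} (R : ℕ) {P : MvPolynomial σ ℂ} (hP0 : coeff 0 P = 1) (hP : Tame κ c P) :
    ∃ W : MvPolynomial σ ℂ, DegEq R (P * W) 1 ∧ Tame κ c W := by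
  refine ⟨∑ t ∈ Finset.range (R + 1), (1 - P) ^ t, ?_, tame_sum _ _ fun t _ => (tame_one.sub hP).pow t⟩
  have hgeom : P * ∑ t ∈ Finset.range (R + 1), (1 - P) ^ t = 1 - (1 - P) ^ (R + 1) := by
    rw [← mul_neg_geom_sum, sub_sub_cancel]
  rw [hgeom]
  refine degEq_of_hasOrd ?_
  rw [sub_sub_cancel_left]
  refine (HasOrd.pow (hasOrd_one_of_coeff_zero ?_) (R + 1)).neg
  rw [coeff_sub, coeff_zero_one, hP0, sub_self]

end TameDeg

/-! ## The Euler derivation of a linear weight -/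

/-- The Euler derivation `θ_κ = Σ_v κ_v · Y_v ∂_v`. [folklore] -/
def euler (κ : σ → ℝ) : Derivation ℂ (MvPolynomial σ ℂ) (MvPolynomial σ ℂ) :=
  MvPolynomial.mkDerivation ℂ fun v : σ => ((κ v : ℝ) : ℂ) • (X v : MvPolynomial σ ℂ)

omit [Fintype σ] in
/-- One summand of the Euler derivation on a monomial. [folklore] -/
theorem monomial_tsub_smul_X (κ : σ → ℝ) (s : σ →₀ ℕ) (v : σ) :
    (monomial (s - Finsupp.single v 1) ((s v : ℕ) : ℂ) : MvPolynomial σ ℂ) •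
        (((κ v : ℝ) : ℂ) • (X v : MvPolynomial σ ℂ)) =
      (((κ v : ℝ) : ℂ) * ((s v : ℕ) : ℂ)) • monomial s (1 : ℂ) := by
  classical
  rw [smul_eq_mul, mul_smul_comm, mul_smul]
  congr 1
  by_cases h : s v = 0
  · simp [h]
  · rw [X, monomial_mul, mul_one,
      tsub_add_cancel_of_le (Finsupp.single_le_iff.mpr (Nat.one_le_iff_ne_zero.mpr h)),
      smul_monomial, smul_eq_mul, mul_one]

/-- The Euler derivation on a monomial: `θ_κ (a·Y^s) = lw κ s · a·Y^s`. [folklore] -/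
theorem euler_monomial (κ : σ → ℝ) (s : σ →₀ ℕ) (a : ℂ) :
    euler κ (monomial s a) = ((lw κ s : ℝ) : ℂ) • monomial s a := by
  classical
  unfold euler
  rw [MvPolynomial.mkDerivation_monomial, Finsupp.sum_fintype _ _ (fun i => by simp)]
  simp_rw [monomial_tsub_smul_X]
  rw [← Finset.sum_smul, smul_smul, smul_monomial, smul_monomial]
  congr 1
  simp only [lw, Complex.ofReal_sum, Complex.ofReal_mul, Complex.ofReal_natCast, smul_eq_mul, mul_one]
  rw [mul_comm]
  congr 1
  exact Finset.sum_congr rfl fun v _ => mul_comm _ _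

/-- Coefficient formula for the Euler derivation: `coeff e (θ_κ P) = lw κ e · coeff e P`. [folklore] -/
theorem coeff_euler (κ : σ → ℝ) (P : MvPolynomial σ ℂ) (e : σ →₀ ℕ) :
    coeff e (euler κ P) = ((lw κ e : ℝ) : ℂ) * coeff e P := by
  classical
  induction P using MvPolynomial.induction_on' with
  | monomial s a =>
    rw [euler_monomial, coeff_smul, coeff_monomial, smul_eq_mul]
    split_ifs with h
    · subst h; rfl
    · rw [mul_zero, mul_zero]
  | add p q hp hq => rw [map_add, coeff_add, coeff_add, hp, hq, mul_add]

/-- The Euler derivation does not enlarge supports. [folklore] -/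
theorem support_euler_subset (κ : σ → ℝ) (P : MvPolynomial σ ℂ) : (euler κ P).support ⊆ P.support := by
  intro e he
  rw [mem_support_iff, coeff_euler] at he
  rw [mem_support_iff]
  exact fun h => he (by rw [h, mul_zero])

/-- The Euler derivation preserves tameness. [folklore] -/
theorem Tame.euler {κ : σ → ℝ} {c : ℝ} {P : MvPolynomial σ ℂ} (hP : Tame κ c P) : Tame κ c (euler κ P) :=
  fun e he => hP e (support_euler_subset κ P he)

/-- The Euler derivation respects top congruences. [folklore] -/
theorem TopEq.euler {κ : σ → ℝ} {w₀ : ℝ} {P Q : MvPolynomial σ ℂ} (h : TopEq κ w₀ P Q) :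
    TopEq κ w₀ (euler κ P) (euler κ Q) := fun e he => by rw [coeff_euler, coeff_euler, h e he]

/-- The Euler derivation kills constants: `θ_κ P` has no constant term. [folklore] -/
theorem coeff_zero_euler (κ : σ → ℝ) (P : MvPolynomial σ ℂ) : coeff 0 (euler κ P) = 0 := by
  rw [coeff_euler, lw_zero, Complex.ofReal_zero, zero_mul]


/-! ## Truncated logarithms and the Wronskian transport (upstairs `stub_logLinearisation`) -/

section Wronskian
variable {κ : σ → ℝ} {c w₀ : ℝ}

/-- The truncated logarithm `log_N (1 + ℓ) = Σ_{r=1}^{N} ((−1)^{r+1}/r) ℓ^r`. [folklore] -/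
def logT (N : ℕ) (ℓ : MvPolynomial σ ℂ) : MvPolynomial σ ℂ :=
  ∑ r ∈ Finset.Icc 1 N, ((-1 : ℂ) ^ (r + 1) / (r : ℂ)) • ℓ ^ r

omit [Fintype σ] in
/-- The truncated logarithm has no constant term when `ℓ` has none. [folklore] -/
theorem coeff_zero_logT (N : ℕ) {ℓ : MvPolynomial σ ℂ} (hℓ : coeff 0 ℓ = 0) : coeff 0 (logT N ℓ) = 0 := by
  unfold logT
  rw [coeff_sum]
  refine Finset.sum_eq_zero fun r hr => ?_
  rw [Finset.mem_Icc] at hr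
  rw [coeff_smul, ← constantCoeff_eq, map_pow, constantCoeff_eq, hℓ, zero_pow (by omega), smul_zero]

/-- The truncated logarithm of a tame `ℓ` is tame. [folklore] -/
theorem Tame.logT (N : ℕ) {ℓ : MvPolynomial σ ℂ} (hℓ : Tame κ c ℓ) : Tame κ c (logT N ℓ) :=
  tame_sum _ _ fun r _ => (hℓ.pow r).smul _

omit [Fintype σ] in
/-- Exact derivative of the truncated logarithm: `D (log_N (1+ℓ)) = D ℓ · Σ_{t<N} (−ℓ)^t`. [folklore] -/
theorem deriv_logT (D : Derivation ℂ (MvPolynomial σ ℂ) (MvPolynomial σ ℂ)) (ℓ : MvPolynomial σ ℂ) (N : ℕ) :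
    D (logT N ℓ) = D ℓ * ∑ t ∈ Finset.range N, (-ℓ) ^ t := by
  unfold logT
  induction N with
  | zero => simp
  | succ N ih =>
    rw [Finset.sum_Icc_succ_top (by omega), map_add, ih, Finset.sum_range_succ, mul_add]
    congr 1
    rw [D.map_smul, D.leibniz_pow, Nat.add_sub_cancel, smul_eq_mul, ← Nat.cast_smul_eq_nsmul ℂ, smul_smul,
      div_mul_cancel₀ _ (Nat.cast_ne_zero.mpr (Nat.succ_ne_zero N)), MvPolynomial.smul_eq_C_mul, map_pow, map_neg,
      map_one, neg_pow ℓ]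
    ring

omit [Fintype σ] in
/-- `(1 + ℓ) · D (log_{R+1} (1+ℓ)) ≡ D ℓ` in degree `≤ R`, for `ℓ` without constant term. [folklore] -/
theorem degEq_one_add_mul_deriv_logT (D : Derivation ℂ (MvPolynomial σ ℂ) (MvPolynomial σ ℂ)) {ℓ : MvPolynomial σ ℂ}
    (hℓ : coeff 0 ℓ = 0) (R : ℕ) : DegEq R ((1 + ℓ) * D (logT (R + 1) ℓ)) (D ℓ) := by
  rw [deriv_logT, mul_left_comm, show (1 + ℓ) * ∑ t ∈ Finset.range (R + 1), (-ℓ) ^ t = 1 - (-ℓ) ^ (R + 1) by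
    rw [← mul_neg_geom_sum, sub_neg_eq_add], mul_sub, mul_one]
  refine degEq_of_hasOrd ?_
  rw [sub_sub_cancel_left, ← mul_neg]
  have h1 : HasOrd 1 (-ℓ) := (hasOrd_one_of_coeff_zero hℓ).neg
  simpa using (hasOrd_zero (D ℓ)).mul ((h1.pow (R + 1)).neg)

omit [Fintype σ] in
/-- `(∏ (1 + ℓ_i)) · D (Σ log_{R+1}(1 + ℓ_i)) ≡ D ∏ (1 + ℓ_i)` in degree `≤ R`. [folklore] -/
theorem degEq_prod_mul_deriv_logT {ι : Type*} (D : Derivation ℂ (MvPolynomial σ ℂ) (MvPolynomial σ ℂ))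
    (ℓ : ι → MvPolynomial σ ℂ) (hℓ : ∀ i, coeff 0 (ℓ i) = 0) (R : ℕ) (s : Finset ι) :
    DegEq R ((∏ i ∈ s, (1 + ℓ i)) * D (∑ i ∈ s, logT (R + 1) (ℓ i))) (D (∏ i ∈ s, (1 + ℓ i))) := by
  classical
  induction s using Finset.induction_on with
  | empty => intro e _; simp
  | insert a s ha ih =>
    rw [Finset.prod_insert ha, Finset.sum_insert ha, map_add, D.leibniz, smul_eq_mul, smul_eq_mul,
      show (1 + ℓ a) * (∏ i ∈ s, (1 + ℓ i)) * (D (logT (R + 1) (ℓ a)) + D (∑ i ∈ s, logT (R + 1) (ℓ i))) =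
        (∏ i ∈ s, (1 + ℓ i)) * ((1 + ℓ a) * D (logT (R + 1) (ℓ a))) +
          (1 + ℓ a) * ((∏ i ∈ s, (1 + ℓ i)) * D (∑ i ∈ s, logT (R + 1) (ℓ i))) by ring]
    have h1 := (degEq_one_add_mul_deriv_logT D (hℓ a) R).mul_left (∏ i ∈ s, (1 + ℓ i))
    have h2 := ih.mul_left (1 + ℓ a)
    refine (h1.add h2).trans ?_
    intro e _
    congr 1
    rw [map_add D (1 : MvPolynomial σ ℂ) (ℓ a), D.map_one_eq_zero, zero_add]
    ring

omit [Fintype σ] in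
/-- THE WRONSKIAN CONGRUENCE upstairs: `P·Q·D Λ ≡ D F·Q − F·D Q` in degree `≤ R`, `P = ∏(1+ℓ)`, `Q = ∏(1+ℓ')`, `F = P − Q`,
`Λ = Σ log_{R+1}(1+ℓ) − Σ log_{R+1}(1+ℓ')`. [folklore] -/
theorem degEq_wronskian {ι ι' : Type*} (D : Derivation ℂ (MvPolynomial σ ℂ) (MvPolynomial σ ℂ)) (s : Finset ι) (s' : Finset ι')
    (ℓ : ι → MvPolynomial σ ℂ) (ℓ' : ι' → MvPolynomial σ ℂ) (hℓ : ∀ i, coeff 0 (ℓ i) = 0) (hℓ' : ∀ i, coeff 0 (ℓ' i) = 0)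
    (R : ℕ) :
    DegEq R ((∏ i ∈ s, (1 + ℓ i)) * (∏ i ∈ s', (1 + ℓ' i)) *
        D (∑ i ∈ s, logT (R + 1) (ℓ i) - ∑ i ∈ s', logT (R + 1) (ℓ' i)))
      (D (∏ i ∈ s, (1 + ℓ i) - ∏ i ∈ s', (1 + ℓ' i)) * ∏ i ∈ s', (1 + ℓ' i) -
        (∏ i ∈ s, (1 + ℓ i) - ∏ i ∈ s', (1 + ℓ' i)) * D (∏ i ∈ s', (1 + ℓ' i))) := by
  have hu := (degEq_prod_mul_deriv_logT D ℓ hℓ R s).mul_left (∏ i ∈ s', (1 + ℓ' i))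
  have hv := (degEq_prod_mul_deriv_logT D ℓ' hℓ' R s').mul_left (∏ i ∈ s, (1 + ℓ i))
  have eq1 : (∏ i ∈ s, (1 + ℓ i)) * (∏ i ∈ s', (1 + ℓ' i)) *
        D (∑ i ∈ s, logT (R + 1) (ℓ i) - ∑ i ∈ s', logT (R + 1) (ℓ' i)) =
      (∏ i ∈ s', (1 + ℓ' i)) * ((∏ i ∈ s, (1 + ℓ i)) * D (∑ i ∈ s, logT (R + 1) (ℓ i))) -
        (∏ i ∈ s, (1 + ℓ i)) * ((∏ i ∈ s', (1 + ℓ' i)) * D (∑ i ∈ s', logT (R + 1) (ℓ' i))) := by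
    rw [map_sub]; ring
  have eq2 : D (∏ i ∈ s, (1 + ℓ i) - ∏ i ∈ s', (1 + ℓ' i)) * ∏ i ∈ s', (1 + ℓ' i) -
        (∏ i ∈ s, (1 + ℓ i) - ∏ i ∈ s', (1 + ℓ' i)) * D (∏ i ∈ s', (1 + ℓ' i)) =
      (∏ i ∈ s', (1 + ℓ' i)) * D (∏ i ∈ s, (1 + ℓ i)) - (∏ i ∈ s, (1 + ℓ i)) * D (∏ i ∈ s', (1 + ℓ' i)) := by
    rw [map_sub]; ring
  rw [eq1, eq2]
  exact hu.sub hv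

omit [Fintype σ] in
/-- Constant term of a product `∏ (1 + ℓ_i)` of factors without constant term. [folklore] -/
theorem coeff_zero_prod_one_add {ι : Type*} (s : Finset ι) (ℓ : ι → MvPolynomial σ ℂ) (hℓ : ∀ i, coeff 0 (ℓ i) = 0) :
    coeff 0 (∏ i ∈ s, (1 + ℓ i)) = 1 := by
  rw [← constantCoeff_eq, map_prod]
  refine Finset.prod_eq_one fun i _ => ?_
  rw [map_add, map_one, constantCoeff_eq, hℓ i, add_zero]

/-- A monomial top-congruent to a tame polynomial is tame. [folklore] -/
theorem tame_monomial_of_topEq {F : MvPolynomial σ ℂ} (hF : Tame κ c F) {e₀ : σ →₀ ℕ} (he₀ : lw κ e₀ = w₀) {G : ℂ}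
    (htop : TopEq κ w₀ F (monomial e₀ G)) : Tame κ c (monomial e₀ G) := by
  classical
  by_cases hG : G = 0
  · rw [hG, monomial_zero]; exact tame_zero
  · refine tame_monomial ?_ G
    refine hF e₀ ?_
    rw [mem_support_iff, htop e₀ (by rw [he₀]), coeff_monomial, if_pos rfl]
    exact hG

/-- **TOP TRANSPORT** (upstairs `stub_logLinearisation`, one direction): if `F = ∏(1+ℓ) − ∏(1+ℓ')` is top-congruent at level `w₀` to a
single monomial `G·Y^{e₀}` of weight `w₀`, all `ℓ, ℓ'` tame without constant term, then so is the truncated log-sum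
`Λ = Σ log_{R+1}(1+ℓ) − Σ log_{R+1}(1+ℓ')` for every `R` with `−w₀ ≤ c·R`. [folklore] -/
theorem topEq_logT_of_topEq_prod {ι ι' : Type*} (hc : 0 < c) (s : Finset ι) (s' : Finset ι')
    (ℓ : ι → MvPolynomial σ ℂ) (ℓ' : ι' → MvPolynomial σ ℂ) (hℓ0 : ∀ i, coeff 0 (ℓ i) = 0) (hℓ'0 : ∀ i, coeff 0 (ℓ' i) = 0)
    (hℓ : ∀ i, Tame κ c (ℓ i)) (hℓ' : ∀ i, Tame κ c (ℓ' i)) {e₀ : σ →₀ ℕ} (he₀ : lw κ e₀ = w₀) {G : ℂ}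
    (htop : TopEq κ w₀ (∏ i ∈ s, (1 + ℓ i) - ∏ i ∈ s', (1 + ℓ' i)) (monomial e₀ G)) {R : ℕ} (hR : -w₀ ≤ c * R) :
    TopEq κ w₀ (∑ i ∈ s, logT (R + 1) (ℓ i) - ∑ i ∈ s', logT (R + 1) (ℓ' i)) (monomial e₀ G) := by
  classical
  set P := ∏ i ∈ s, (1 + ℓ i) with hPdef
  set Q := ∏ i ∈ s', (1 + ℓ' i) with hQdef
  set F := P - Q with hFdef
  set Λ := ∑ i ∈ s, logT (R + 1) (ℓ i) - ∑ i ∈ s', logT (R + 1) (ℓ' i) with hΛdef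
  set θ := euler κ with hθ
  -- tameness
  have hPt : Tame κ c P := tame_prod _ _ fun i _ => tame_one.add (hℓ i)
  have hQt : Tame κ c Q := tame_prod _ _ fun i _ => tame_one.add (hℓ' i)
  have hFt : Tame κ c F := hPt.sub hQt
  have hΛt : Tame κ c Λ := (tame_sum _ _ fun i _ => (hℓ i).logT _).sub (tame_sum _ _ fun i _ => (hℓ' i).logT _)
  have hMt : Tame κ c (monomial e₀ G) := tame_monomial_of_topEq hFt he₀ htop
  have hP0 : coeff 0 P = 1 := coeff_zero_prod_one_add s ℓ hℓ0
  have hQ0 : coeff 0 Q = 1 := coeff_zero_prod_one_add s' ℓ' hℓ'0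
  have hPQ0 : coeff 0 (P * Q) = 1 := by
    rw [← constantCoeff_eq, map_mul, constantCoeff_eq, hP0, hQ0, mul_one]
  have hc0 : (0 : ℝ) ≤ c := hc.le
  -- θ F ≡ w₀ G Y^{e₀}
  have hθmono : θ (monomial e₀ G) = monomial e₀ (((w₀ : ℝ) : ℂ) * G) := by
    rw [hθ, euler_monomial, he₀, smul_monomial, smul_eq_mul]
  have hθF : TopEq κ w₀ (θ F) (monomial e₀ (((w₀ : ℝ) : ℂ) * G)) := by
    rw [← hθmono]; exact htop.euler
  have hMt' : Tame κ c (monomial e₀ (((w₀ : ℝ) : ℂ) * G)) := by rw [← hθmono]; exact hMt.euler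
  -- the Wronskian is ≡ w₀ G Y^{e₀}
  have hW1 : TopEq κ w₀ (θ F * Q) (monomial e₀ (((w₀ : ℝ) : ℂ) * G)) :=
    (TopEq.mul hc0 hFt.euler hMt' hQt hQt hθF (topEq_refl Q)).trans
      (topEq_monomial_mul_of_coeff_zero_eq_one hc he₀ _ hQt hQ0)
  have hW2 : TopEq κ w₀ (F * θ Q) 0 :=
    (TopEq.mul hc0 hFt hMt hQt.euler hQt.euler htop (topEq_refl _)).trans
      (topEq_monomial_mul_of_coeff_zero_eq_zero hc he₀ _ hQt.euler (coeff_zero_euler κ Q))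
  have hW : TopEq κ w₀ (θ F * Q - F * θ Q) (monomial e₀ (((w₀ : ℝ) : ℂ) * G)) := by
    have := hW1.sub hW2; rwa [sub_zero] at this
  -- P Q θ Λ ≡ Wronskian (degree congruence ⇒ top congruence)
  have hdeg : DegEq R (P * Q * θ Λ) (θ F * Q - F * θ Q) :=
    degEq_wronskian θ s s' ℓ ℓ' hℓ0 hℓ'0 R
  have hPQΛ : TopEq κ w₀ (P * Q * θ Λ) (monomial e₀ (((w₀ : ℝ) : ℂ) * G)) :=
    (topEq_of_degEq hc hR ((hPt.mul hQt).mul hΛt.euler) ((hFt.euler.mul hQt).sub (hFt.mul hQt.euler)) hdeg).trans hW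
  -- peel P Q
  obtain ⟨W, hWdeg, hWt⟩ := exists_degEq_mul_one (κ := κ) (c := c) R hPQ0 (hPt.mul hQt)
  have hW0 : coeff 0 W = 1 := by
    have h := hWdeg 0 (by simp)
    rwa [← constantCoeff_eq, map_mul, constantCoeff_eq, hPQ0, one_mul, coeff_zero_one] at h
  have hθΛ : TopEq κ w₀ (θ Λ) (monomial e₀ (((w₀ : ℝ) : ℂ) * G)) := by
    have h1 : DegEq R (θ Λ * (P * Q * W)) (θ Λ * 1) := hWdeg.mul_left (θ Λ)
    have h1' : TopEq κ w₀ (θ Λ) (θ Λ * (P * Q * W)) := by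
      have := topEq_of_degEq hc hR (hΛt.euler.mul ((hPt.mul hQt).mul hWt)) (by rw [mul_one]; exact hΛt.euler) h1
      rw [mul_one] at this
      exact this.symm
    refine h1'.trans ?_
    rw [show θ Λ * (P * Q * W) = P * Q * θ Λ * W by ring]
    exact (TopEq.mul hc0 ((hPt.mul hQt).mul hΛt.euler) hMt' hWt hWt hPQΛ (topEq_refl W)).trans
      (topEq_monomial_mul_of_coeff_zero_eq_one hc he₀ _ hWt hW0)
  -- divide by the weight
  have hΛ0 : coeff 0 Λ = 0 := by
    rw [hΛdef, coeff_sub, coeff_sum, coeff_sum, Finset.sum_eq_zero fun i _ => coeff_zero_logT _ (hℓ0 i),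
      Finset.sum_eq_zero fun i _ => coeff_zero_logT _ (hℓ'0 i), sub_zero]
  have hF0 : coeff 0 F = 0 := by rw [hFdef, coeff_sub, hP0, hQ0, sub_self]
  intro e he
  have key := hθΛ e he
  rw [hθ, coeff_euler, coeff_monomial] at key
  rw [coeff_monomial]
  by_cases hwe : lw κ e = 0
  · -- weight zero: `e` is not in the support of anything tame unless `e = 0`
    have hΛe : coeff e Λ = 0 := by
      by_cases he0 : e = 0
      · rw [he0]; exact hΛ0
      · by_contra hne
        exact absurd (hΛt.lw_neg hc (mem_support_iff.mpr hne) he0) (by rw [hwe]; exact lt_irrefl 0)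
    rw [hΛe]
    split_ifs with hee
    · have hG : coeff e F = G := by rw [htop e he, coeff_monomial, if_pos hee]
      by_cases he0 : e = 0
      · rw [← hG, he0, hF0]
      · by_contra hne
        have : e ∈ F.support := by rw [mem_support_iff, hG]; exact Ne.symm hne
        exact absurd (hFt.lw_neg hc this he0) (by rw [hwe]; exact lt_irrefl 0)
    · rfl
  · split_ifs at key with hee
    · rw [if_pos hee]
      have hwe₀ : lw κ e = w₀ := by rw [← hee, he₀]
      rw [hwe₀] at key
      have hw0 : ((w₀ : ℝ) : ℂ) ≠ 0 := by
        rw [← hwe₀]; exact_mod_cast hwe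
      exact mul_left_cancel₀ hw0 key
    · rw [if_neg hee]
      have hw : ((lw κ e : ℝ) : ℂ) ≠ 0 := by exact_mod_cast hwe
      exact (mul_eq_zero.mp key).resolve_left hw

end Wronskian

end Wronskian

end Summit.ValiantsHypothesis.ValiantsHypothesis.Theorems.NewtonUnitEquations.TwoProducts.MomentRecord.Lift

end
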